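import Mathlib
import HarnessLib

/-!
# K1L_D (stmt-AnomalousDissipation-27980), registry v8 — W7 ENGINE, SCALAR SPINE §1–§3 (ramped-slot Grönwall, period ⇒ profile, drain-weight floor)
# (helper; `--supports stmt-AnomalousDissipation-27980 --as helper`)

Theorems-side landing of planner ad-ideate-p5 g10's kernel-checked crux workfile `Cruxes/LagrangianRenormalisationStep/Lines/onelevel_W7_engine.lean`
(crux write commit d2cfba26e719, 0 sorry), §1–§3 VERBATIM (declarations, statements and proofs unchanged; only the namespace moves from
`…Cruxes.LagrangianRenormalisationStep.W7Engine` to `…Theorems.SolenoidalFractalHomogenisation.LagrangianStep.W7Engine` so that the W7 assembly and the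
registry can import it — `Lines` modules are not part of the farm build).  §4 (trapezoid right derivatives, with the helper `trapDeriv`) lands separately.
Landed by the `stub_compactRange` taker (prover ad-sawtooth-k1loc-p1 g11) as the first assembly input; authorship of the mathematics: p5 g10 (lens «profile»),
companion of p4 g13's three-mode form inequality (`Lines/onelevel_W7_threemode_vector.lean`, memo `Lines/onelevel-W7-threemode.md` §5 steps S3–S4).

What is here is the part of the W7 proof (`stub_compactRange` / `stub_largeR` of registry v8, i.e. ONE theorem `ClassDecayW cubatureWord … admAll`) that is
PURE REAL ANALYSIS, stated so that the W7 assembly instantiates it verbatim: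
* §1 `gronwall_right_exp` — variable-rate Grönwall from a RIGHT-derivative bound `Φ'₊ ≤ −σ(t)·Φ` (`σ` continuous, any sign):
  `Φ t₁ ≤ exp(−∫_{t₀}^{t₁} σ)·Φ t₀`; `rate_transfer` — from `Φ' ≤ −ρ·E` and `c₁E ≤ Φ ≤ c₂E` to `Φ' ≤ −σΦ` with the SIGNED rate
  `σ = min(ρ/c₂, ρ/c₁)` (`min_div_eq_pos_sub_neg`); `slot_contraction` — `Φ = E` at both slot ends ⇒ `E t₁ ≤ exp(−∫ min(ρ/c₂, ρ/c₁))·E t₀` with NO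
  prefactor; `slot_contraction_of_nonneg`.
* §2 `iterate_period`, `profile_of_period_contraction` — an antitone energy contracting by `e^{−κ}` over each period `P` decays like `e^{κ}·e^{−κ(t−t₀)/P}`;
  `profile_capped` (`CK = e`), `rate_as_cK`, `cK_nu_free` — the `ClassDecayW` bookkeeping `exp(−(κ'/P)t) = exp(−(2·cK·ν·t))`, `cK = κ'/(2νP)` ν-free for `P = 3720M/ν`.
* §3 `qmin_lower` — the geometric floor of the drain weight `c₊² + c₋² ≥ 2(q̂·m)²/(|m| + k̃)²`.
No definitions, no named facts, no sorry; nothing here is specific to the cubature word.  NOT a proof of the crux / of AD; rung F-D1.A0.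
[cite: BedrossianCotiZelati2017, §2 (hypocoercivity functional for shear flows: Grönwall on an equivalent functional)] [problem: turb]
-/

set_option linter.dupNamespace false

namespace Summit.AnomalousDissipation.AnomalousDissipation.Theorems.SolenoidalFractalHomogenisation.LagrangianStep.W7Engine

open Set Real MeasureTheory intervalIntegral

/-! ## §1  Ramped-slot Grönwall with right derivatives -/

/-- Variable-rate Grönwall from a right-derivative bound: if `Φ` is continuous on `[t₀, t₁]`, has right derivative `φ' t` at every
`t ∈ [t₀, t₁)` with `φ' t ≤ −σ t · Φ t` for a continuous (signed) rate `σ`, then `Φ t₁ ≤ exp(−∫_{t₀}^{t₁} σ) · Φ t₀`. -/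
theorem gronwall_right_exp {Φ φ' σ : ℝ → ℝ} {t₀ t₁ : ℝ} (ht : t₀ ≤ t₁)
    (hΦc : ContinuousOn Φ (Icc t₀ t₁)) (hΦd : ∀ t ∈ Ico t₀ t₁, HasDerivWithinAt Φ (φ' t) (Ici t) t)
    (hσ : Continuous σ) (hineq : ∀ t ∈ Ico t₀ t₁, φ' t ≤ -σ t * Φ t) :
    Φ t₁ ≤ Real.exp (-∫ s in t₀..t₁, σ s) * Φ t₀ := by
  set I : ℝ → ℝ := fun t => ∫ s in t₀..t, σ s with hI
  have hId : ∀ t, HasDerivAt I (σ t) t := fun t => (hσ.integral_hasStrictDerivAt t₀ t).hasDerivAt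
  have hIc : Continuous I := continuous_iff_continuousAt.2 fun t => (hId t).continuousAt
  set G : ℝ → ℝ := fun t => Real.exp (I t) * Φ t with hG
  have hGc : ContinuousOn G (Icc t₀ t₁) := (Real.continuous_exp.comp hIc).continuousOn.mul hΦc
  have hGd : ∀ t ∈ Ico t₀ t₁,
      HasDerivWithinAt G (Real.exp (I t) * σ t * Φ t + Real.exp (I t) * φ' t) (Ici t) t := by
    intro t ht
    have h1 : HasDerivWithinAt (fun s => Real.exp (I s)) (Real.exp (I t) * σ t) (Ici t) t :=
      ((Real.hasDerivAt_exp (I t)).comp t (hId t)).hasDerivWithinAt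
    exact h1.mul (hΦd t ht)
  have hB : ∀ t ∈ Ico t₀ t₁, HasDerivWithinAt (fun _ : ℝ => G t₀) 0 (Ici t) t := fun t _ => hasDerivWithinAt_const _ _ _
  have bound : ∀ t ∈ Ico t₀ t₁, Real.exp (I t) * σ t * Φ t + Real.exp (I t) * φ' t ≤ 0 := by
    intro t ht
    have := hineq t ht
    have hpos : 0 < Real.exp (I t) := Real.exp_pos _
    nlinarith
  have key := image_le_of_deriv_right_le_deriv_boundary hGc hGd (B := fun _ => G t₀) (B' := fun _ => 0)
    (le_refl (G t₀)) continuousOn_const hB bound (right_mem_Icc.2 ht)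
  have hI0 : I t₀ = 0 := by simp [hI]
  have hG0 : G t₀ = Φ t₀ := by simp [hG, hI0]
  -- key : exp (I t₁) * Φ t₁ ≤ G t₀ = Φ t₀
  rw [hG0] at key
  have hpos : 0 < Real.exp (-I t₁) := Real.exp_pos _
  have : Real.exp (-I t₁) * (Real.exp (I t₁) * Φ t₁) ≤ Real.exp (-I t₁) * Φ t₀ :=
    mul_le_mul_of_nonneg_left key hpos.le
  calc Φ t₁ = Real.exp (-I t₁) * (Real.exp (I t₁) * Φ t₁) := by
          rw [← mul_assoc, ← Real.exp_add]; simp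
    _ ≤ Real.exp (-I t₁) * Φ t₀ := this

/-- The signed rate: `min(ρ/c₂, ρ/c₁) = ρ⁺/c₂ − ρ⁻/c₁` for `0 < c₁ ≤ c₂`. -/
theorem min_div_eq_pos_sub_neg {ρ c₁ c₂ : ℝ} (hc₁ : 0 < c₁) (hc₁₂ : c₁ ≤ c₂) :
    min (ρ / c₂) (ρ / c₁) = max ρ 0 / c₂ - max (-ρ) 0 / c₁ := by
  have hc₂ : 0 < c₂ := lt_of_lt_of_le hc₁ hc₁₂
  rcases le_or_gt 0 ρ with hρ | hρ
  · have h1 : ρ / c₂ ≤ ρ / c₁ := div_le_div_of_nonneg_left hρ hc₁ hc₁₂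
    rw [min_eq_left h1, max_eq_left hρ, max_eq_right (by linarith)]; simp
  · have h1 : ρ / c₁ ≤ ρ / c₂ := by
      rw [div_eq_mul_one_div ρ c₁, div_eq_mul_one_div ρ c₂]
      exact mul_le_mul_of_nonpos_left (one_div_le_one_div_of_le hc₁ hc₁₂) hρ.le
    rw [min_eq_right h1, max_eq_right hρ.le, max_eq_left (by linarith)]
    field_simp
    ring

/-- RATE TRANSFER through the norm equivalence: `Φ' ≤ −ρE`, `c₁E ≤ Φ ≤ c₂E`, `0 < c₁ ≤ c₂` give `Φ' ≤ −min(ρ/c₂, ρ/c₁)·Φ`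
(for `ρ ≥ 0` the rate is `ρ/c₂`; for `ρ < 0` the LOSS is amplified to `ρ/c₁`; no sign assumption on `E` is needed). -/
theorem rate_transfer {φ' ρ E Φ c₁ c₂ : ℝ} (hc₁ : 0 < c₁) (hc₁₂ : c₁ ≤ c₂)
    (hlo : c₁ * E ≤ Φ) (hhi : Φ ≤ c₂ * E) (h : φ' ≤ -ρ * E) :
    φ' ≤ -(min (ρ / c₂) (ρ / c₁)) * Φ := by
  have hc₂ : 0 < c₂ := lt_of_lt_of_le hc₁ hc₁₂
  rcases le_or_gt 0 ρ with hρ | hρ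
  · have h1 : ρ / c₂ ≤ ρ / c₁ := div_le_div_of_nonneg_left hρ hc₁ hc₁₂
    rw [min_eq_left h1]
    have h2 : ρ / c₂ * Φ ≤ ρ / c₂ * (c₂ * E) := mul_le_mul_of_nonneg_left hhi (div_nonneg hρ hc₂.le)
    have h3 : ρ / c₂ * (c₂ * E) = ρ * E := by field_simp
    linarith
  · have h1 : ρ / c₁ ≤ ρ / c₂ := by
      rw [div_eq_mul_one_div ρ c₁, div_eq_mul_one_div ρ c₂]
      exact mul_le_mul_of_nonpos_left (one_div_le_one_div_of_le hc₁ hc₁₂) hρ.le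
    rw [min_eq_right h1]
    have hneg : ρ / c₁ < 0 := div_neg_of_neg_of_pos hρ hc₁
    have h2 : ρ / c₁ * Φ ≤ ρ / c₁ * (c₁ * E) := mul_le_mul_of_nonpos_left hlo hneg.le
    have h3 : ρ / c₁ * (c₁ * E) = ρ * E := by field_simp
    linarith

/-- SLOT CONTRACTION WITH NO PREFACTOR (memo §3): a functional `Φ` with right derivative `φ' ≤ −ρ(t)·E`, sandwiched
`c₁E ≤ Φ ≤ c₂E` (`0 < c₁ ≤ c₂`), `ρ` continuous of any sign, and `Φ = E` at both slot ends (ramped envelope: the cross term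
vanishes where the layer amplitude does) gives `E t₁ ≤ exp(−∫_{t₀}^{t₁} min(ρ/c₂, ρ/c₁))·E t₀`. -/
theorem slot_contraction {E Φ φ' ρ : ℝ → ℝ} {t₀ t₁ c₁ c₂ : ℝ} (ht : t₀ ≤ t₁) (hc₁ : 0 < c₁) (hc₁₂ : c₁ ≤ c₂)
    (hΦc : ContinuousOn Φ (Icc t₀ t₁)) (hΦd : ∀ t ∈ Ico t₀ t₁, HasDerivWithinAt Φ (φ' t) (Ici t) t)
    (hρ : Continuous ρ) (hineq : ∀ t ∈ Ico t₀ t₁, φ' t ≤ -ρ t * E t)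
    (hsand : ∀ t ∈ Icc t₀ t₁, c₁ * E t ≤ Φ t ∧ Φ t ≤ c₂ * E t)
    (h₀ : Φ t₀ = E t₀) (h₁ : Φ t₁ = E t₁) :
    E t₁ ≤ Real.exp (-∫ s in t₀..t₁, min (ρ s / c₂) (ρ s / c₁)) * E t₀ := by
  have hσ : Continuous fun s => min (ρ s / c₂) (ρ s / c₁) := (hρ.div_const _).min (hρ.div_const _)
  have hineq' : ∀ t ∈ Ico t₀ t₁, φ' t ≤ -(min (ρ t / c₂) (ρ t / c₁)) * Φ t := fun t ht =>
    rate_transfer hc₁ hc₁₂ (hsand t (Ico_subset_Icc_self ht)).1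
      (hsand t (Ico_subset_Icc_self ht)).2 (hineq t ht)
  have := gronwall_right_exp ht hΦc hΦd hσ hineq'
  rwa [h₀, h₁] at this

/-- The `ρ ≥ 0` form (no negative net drain anywhere in the slot): `E t₁ ≤ exp(−(1/c₂)·∫_{t₀}^{t₁} ρ)·E t₀`. -/
theorem slot_contraction_of_nonneg {E Φ φ' ρ : ℝ → ℝ} {t₀ t₁ c₁ c₂ : ℝ} (ht : t₀ ≤ t₁) (hc₁ : 0 < c₁) (hc₁₂ : c₁ ≤ c₂)
    (hΦc : ContinuousOn Φ (Icc t₀ t₁)) (hΦd : ∀ t ∈ Ico t₀ t₁, HasDerivWithinAt Φ (φ' t) (Ici t) t)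
    (hρ : Continuous ρ) (hρ0 : ∀ t ∈ Icc t₀ t₁, 0 ≤ ρ t) (hineq : ∀ t ∈ Ico t₀ t₁, φ' t ≤ -ρ t * E t)
    (hsand : ∀ t ∈ Icc t₀ t₁, c₁ * E t ≤ Φ t ∧ Φ t ≤ c₂ * E t)
    (h₀ : Φ t₀ = E t₀) (h₁ : Φ t₁ = E t₁) :
    E t₁ ≤ Real.exp (-((1 / c₂) * ∫ s in t₀..t₁, ρ s)) * E t₀ := by
  have key := slot_contraction ht hc₁ hc₁₂ hΦc hΦd hρ hineq hsand h₀ h₁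
  have hc₂ : 0 < c₂ := lt_of_lt_of_le hc₁ hc₁₂
  have hcongr : ∫ s in t₀..t₁, min (ρ s / c₂) (ρ s / c₁) = ∫ s in t₀..t₁, (1 / c₂) * ρ s := by
    refine intervalIntegral.integral_congr fun s hs => ?_
    rw [uIcc_of_le ht] at hs
    have h1 : ρ s / c₂ ≤ ρ s / c₁ := div_le_div_of_nonneg_left (hρ0 s hs) hc₁ hc₁₂
    simp only [min_eq_left h1]; ring
  rw [hcongr, intervalIntegral.integral_const_mul] at key
  exact key

/-! ## §2  Period product ⇒ the (M′) profile -/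

/-- Iterating a per-period contraction. -/
theorem iterate_period {E : ℝ → ℝ} {t₀ P κ : ℝ}
    (hper : ∀ j : ℕ, E (t₀ + (j + 1) * P) ≤ Real.exp (-κ) * E (t₀ + j * P)) :
    ∀ j : ℕ, E (t₀ + j * P) ≤ Real.exp (-(κ * j)) * E t₀ := by
  intro j
  induction j with
  | zero => simp
  | succ n ih =>
    have h1 := hper n
    have h2 : Real.exp (-κ) * E (t₀ + n * P) ≤ Real.exp (-κ) * (Real.exp (-(κ * n)) * E t₀) :=
      mul_le_mul_of_nonneg_left ih (Real.exp_pos _).le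
    have h3 : Real.exp (-κ) * (Real.exp (-(κ * n)) * E t₀) = Real.exp (-(κ * (n + 1 : ℕ))) * E t₀ := by
      rw [← mul_assoc, ← Real.exp_add]; push_cast; ring_nf
    calc E (t₀ + ((n + 1 : ℕ) : ℝ) * P) = E (t₀ + (n + 1) * P) := by push_cast; ring_nf
      _ ≤ Real.exp (-κ) * E (t₀ + n * P) := h1
      _ ≤ Real.exp (-(κ * (n + 1 : ℕ))) * E t₀ := by rw [← h3]; exact h2

/-- PROFILE FROM PERIOD CONTRACTION (memo §4, `CK`/`cK` bookkeeping): an energy that is antitone on `[t₀, ∞)`, nonnegative at `t₀`,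
and contracts by `e^{−κ}` (`κ ≥ 0`) over each period `[t₀ + jP, t₀ + (j+1)P]` satisfies
`E t ≤ e^{κ} · e^{−(κ/P)(t − t₀)} · E t₀` for all `t ≥ t₀` (one period of transient). -/
theorem profile_of_period_contraction {E : ℝ → ℝ} {t₀ P κ : ℝ} (hP : 0 < P) (hκ : 0 ≤ κ)
    (hanti : AntitoneOn E (Ici t₀)) (hE₀ : 0 ≤ E t₀)
    (hper : ∀ j : ℕ, E (t₀ + (j + 1) * P) ≤ Real.exp (-κ) * E (t₀ + j * P)) {t : ℝ} (ht : t₀ ≤ t) :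
    E t ≤ Real.exp κ * Real.exp (-(κ / P) * (t - t₀)) * E t₀ := by
  set x : ℝ := (t - t₀) / P with hx
  have hx0 : 0 ≤ x := div_nonneg (by linarith) hP.le
  set j : ℕ := ⌊x⌋₊ with hj
  have hjle : (j : ℝ) ≤ x := Nat.floor_le hx0
  have hjlt : x < j + 1 := Nat.lt_floor_add_one x
  have hmem₁ : t₀ + j * P ∈ Ici t₀ := by
    show t₀ ≤ t₀ + j * P; nlinarith [hP.le, (Nat.cast_nonneg j : (0:ℝ) ≤ j)]
  have hmem₂ : t ∈ Ici t₀ := ht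
  have hle : t₀ + j * P ≤ t := by
    have : (j : ℝ) * P ≤ x * P := mul_le_mul_of_nonneg_right hjle hP.le
    have hxP : x * P = t - t₀ := by rw [hx]; field_simp
    linarith
  have h1 : E t ≤ E (t₀ + j * P) := hanti hmem₁ hmem₂ hle
  have h2 : E (t₀ + j * P) ≤ Real.exp (-(κ * j)) * E t₀ := iterate_period hper j
  have h3 : Real.exp (-(κ * j)) ≤ Real.exp κ * Real.exp (-(κ / P) * (t - t₀)) := by
    rw [← Real.exp_add]
    apply Real.exp_le_exp.2
    have hxP : -(κ / P) * (t - t₀) = -(κ * x) := by rw [hx]; field_simp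
    rw [hxP]
    nlinarith [mul_le_mul_of_nonneg_left hjlt.le hκ]
  calc E t ≤ E (t₀ + j * P) := h1
    _ ≤ Real.exp (-(κ * j)) * E t₀ := h2
    _ ≤ Real.exp κ * Real.exp (-(κ / P) * (t - t₀)) * E t₀ := mul_le_mul_of_nonneg_right h3 hE₀

/-- CAPPED PROFILE (`CK = e`): if in addition `E ≥ 0` on `[t₀, ∞)`, replacing `κ` by `min κ 1` gives the transient constant `e`:
`E t ≤ e · exp(−(min κ 1 / P)(t − t₀)) · E t₀`. -/
theorem profile_capped {E : ℝ → ℝ} {t₀ P κ : ℝ} (hP : 0 < P) (hκ : 0 ≤ κ)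
    (hanti : AntitoneOn E (Ici t₀)) (hE : ∀ t, t₀ ≤ t → 0 ≤ E t)
    (hper : ∀ j : ℕ, E (t₀ + (j + 1) * P) ≤ Real.exp (-κ) * E (t₀ + j * P)) {t : ℝ} (ht : t₀ ≤ t) :
    E t ≤ Real.exp 1 * Real.exp (-(min κ 1 / P) * (t - t₀)) * E t₀ := by
  have hκ' : 0 ≤ min κ 1 := le_min hκ zero_le_one
  have hper' : ∀ j : ℕ, E (t₀ + (j + 1) * P) ≤ Real.exp (-min κ 1) * E (t₀ + j * P) := by
    intro j
    have hEj : 0 ≤ E (t₀ + j * P) := hE _ (by nlinarith [hP.le, (Nat.cast_nonneg j : (0:ℝ) ≤ j)])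
    calc E (t₀ + (j + 1) * P) ≤ Real.exp (-κ) * E (t₀ + j * P) := hper j
      _ ≤ Real.exp (-min κ 1) * E (t₀ + j * P) :=
          mul_le_mul_of_nonneg_right (Real.exp_le_exp.2 (neg_le_neg (min_le_left _ _))) hEj
  have key := profile_of_period_contraction hP hκ' hanti (hE t₀ le_rfl) hper' ht
  have h1 : Real.exp (min κ 1) ≤ Real.exp 1 := Real.exp_le_exp.2 (min_le_right _ _)
  have h2 : 0 ≤ Real.exp (-(min κ 1 / P) * (t - t₀)) * E t₀ := mul_nonneg (Real.exp_pos _).le (hE t₀ le_rfl)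
  calc E t ≤ Real.exp (min κ 1) * Real.exp (-(min κ 1 / P) * (t - t₀)) * E t₀ := key
    _ = Real.exp (min κ 1) * (Real.exp (-(min κ 1 / P) * (t - t₀)) * E t₀) := by ring
    _ ≤ Real.exp 1 * (Real.exp (-(min κ 1 / P) * (t - t₀)) * E t₀) := mul_le_mul_of_nonneg_right h1 h2
    _ = Real.exp 1 * Real.exp (-(min κ 1 / P) * (t - t₀)) * E t₀ := by ring

/-- RATE BOOKKEEPING for `ClassDecayW`'s exponent `CK · exp(−(2·cK·ν·t))`: with `t₀ = 0` and `cK := κ'/(2νP)`,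
`exp(−(κ'/P)·(t − 0)) = exp(−(2·cK·ν·t))` (`ν > 0`, `P > 0`).  With `P = 3720·M/ν` (the cubature period at cell viscosity `ν`)
`cK = κ'/(7440·M)` is `ν`-free. -/
theorem rate_as_cK {κ' P ν t : ℝ} (hP : 0 < P) (hν : 0 < ν) :
    Real.exp (-(κ' / P) * (t - 0)) = Real.exp (-(2 * (κ' / (2 * ν * P)) * ν * t)) := by
  congr 1
  field_simp
  ring

/-- The `ν`-free form of `cK` for the cubature period `P = 3720·M/ν`: `κ'/(2ν·P) = κ'/(7440·M)`. -/
theorem cK_nu_free {κ' M ν : ℝ} (hM : 0 < M) (hν : 0 < ν) :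
    κ' / (2 * ν * (3720 * M / ν)) = κ' / (7440 * M) := by
  field_simp
  ring

/-! ## §3  Geometry of the drain weight -/

/-- FLOOR OF THE DRAIN WEIGHT (memo §2): with `k = k̃ > 0`, `x = q̂·m`, `N = |m|`, `n₊ = |K₀ + m| ≤ N + k`, `n₋ = |K₀ − m| ≤ N + k`
(triangle inequality, `|K₀| = k`), the link cosines `c₊ = (k + x)/n₊`, `c₋ = (k − x)/n₋` (`K₀·K_± = k² ± kx`) satisfy
`c₊² + c₋² ≥ 2x²/(N + k)²` — the polarisation-uniform weight `(m̂·q̂)²·2|m|²/(|m|+k̃)²` that `doubleCoverage_sum` sums to `56`. -/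
theorem qmin_lower {k x N np nm : ℝ} (hk : 0 < k) (hN : 0 ≤ N) (hnp : 0 < np) (hnm : 0 < nm)
    (hnp' : np ≤ N + k) (hnm' : nm ≤ N + k) :
    2 * x ^ 2 / (N + k) ^ 2 ≤ ((k + x) / np) ^ 2 + ((k - x) / nm) ^ 2 := by
  have hNk : 0 < N + k := by linarith
  have h1 : ((k + x) / (N + k)) ^ 2 ≤ ((k + x) / np) ^ 2 := by
    rw [div_pow, div_pow]
    exact div_le_div_of_nonneg_left (sq_nonneg _) (by positivity) (pow_le_pow_left₀ hnp.le hnp' 2)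
  have h2 : ((k - x) / (N + k)) ^ 2 ≤ ((k - x) / nm) ^ 2 := by
    rw [div_pow, div_pow]
    exact div_le_div_of_nonneg_left (sq_nonneg _) (by positivity) (pow_le_pow_left₀ hnm.le hnm' 2)
  have h3 : 2 * x ^ 2 / (N + k) ^ 2 ≤ ((k + x) / (N + k)) ^ 2 + ((k - x) / (N + k)) ^ 2 := by
    rw [div_pow, div_pow, ← add_div]
    apply div_le_div_of_nonneg_right _ (by positivity)
    nlinarith [sq_nonneg k, sq_nonneg x]
  linarith

end Summit.AnomalousDissipation.AnomalousDissipation.Theorems.SolenoidalFractalHomogenisation.LagrangianStep.W7Engine
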